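import Summits.AnomalousDissipation.AnomalousDissipation.Theorems.KolmogorovFloor.Negative.Rest
import Summits.AnomalousDissipation.AnomalousDissipation.Theorems.KolmogorovFloor.Negative.AxisBeat
import Summits.AnomalousDissipation.AnomalousDissipation.Theorems.KolmogorovFloor.Negative.BelowTaylorSupport

/-!
# Every band-limited floor class strictly below the Taylor resolution is dead (negative side of `KolmogorovFloor`)

cdisprove seat `refuter-cdisprove-stmt-AnomalousDissipation-14030-0` (2026-08-16).

`KolmogorovFloor` (stmt-AnomalousDissipation-14030) is the `β = 3/4` member of the family of `ν`-uniform FLOOR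
certificate classes with test fields of degree `N ≤ C ν^{-β}`; the dropped `TaylorFloor` (stmt-14085) was
`β = 1/2`. `not_floor_lt_half`: for EVERY exponent `β < 1/2`, every constant `C`, every weight bound `Θ` and EVERY
smooth divergence-free mean-zero force, no such family exists — unconditionally and in Lean (the paper record had
this only via the one-stage phantom / the small-`c` bath). Mechanism, the BEAT AT REST with the AXIS CARRIER:
the floor at rest forces the multiplier `G = Φ₁'(0)` to inject, `ε₀ ≤ (f, G) ≤ A(f)·‖Ĝ(q)‖` at its largest
resolved coefficient `q` (`A(f) = Σ‖f̂(k)‖ < ∞`, Wiener bound); two waves at `p = (3N+1)eᵢ − q`, `p + q`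
(invisible to the coordinates; `|p|, |p+q| ≤ 4N+1`) with amplitude `α² = (10/9)(A(f)+1)` beat at `q` with gain
`≥ (9/10)α²‖Ĝ(q)‖ ≥ (f,G) + ‖Ĝ(q)‖` (`axis_beat_data`) at viscous price `≤ 4500(1+2Θ)C²(A(f)+1)ν^{1−2β} → 0`,
and the sign of the waves disposes of the energy channel: contradiction for `ν` small. At `β = 1/2` the same
witness only kills `C² < ε₀/(4500(1+2Θ)(A(f)+1))` (the known small-`c` calibration); the crux at `β = 3/4` is
untouched by it.
-/

noncomputable section

open MeasureTheory UnitAddTorus Matrix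
open scoped InnerProductSpace ENNReal ComplexConjugate

namespace Summit.AnomalousDissipation.AnomalousDissipation.Theorems.KolmogorovFloor.Negative

open Literature.Analysis.FunctionSpaces Literature.Analysis.FluidPDE
open Summit.AnomalousDissipation.AnomalousDissipation.Theorems.TaylorCertificatePair.Negative

set_option maxHeartbeats 400000 in
/-- **No `ν`-uniform band-limited floor certificate of resolution `N ≤ C ν^{-β}` exists for any `β < 1/2`,
any constants and any force.** (Refutation of every sub-Taylor member of the floor class whose `β = 3/4` member
is the crux `KolmogorovFloor`.) -/
theorem not_floor_lt_half {β : ℝ} (hβ : β < 1 / 2) : ¬ (∃ f : UnitAddTorus (Fin 3) → EuclideanSpace ℝ (Fin 3), Literature.Analysis.FunctionSpaces.Torus.IsSmooth f ∧ Literature.Analysis.FunctionSpaces.Torus.IsDivFree f ∧ Literature.Analysis.FunctionSpaces.Torus.HasZeroMean f ∧ ∃ (ε₀ C Θ ν₀ : ℝ), 0 < ε₀ ∧ 0 < ν₀ ∧ ∀ ν : ℝ, 0 < ν → ν < ν₀ → ∃ (N : ℕ) (Φ₁ : Literature.Analysis.FluidPDE.Torus.CylindricalTest (Fin 3)) (θ₁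 : ℝ), (N : ℝ) ≤ C * ν ^ (-β) ∧ (∀ i, Literature.Analysis.FunctionSpaces.Torus.fourierTruncate N (Φ₁.g i) = Φ₁.g i) ∧ -Θ ≤ θ₁ ∧ θ₁ ≤ 0 ∧ ∀ u : Literature.Analysis.FunctionSpaces.Torus.energySpace (Fin 3), let uf : UnitAddTorus (Fin 3) → EuclideanSpace ℝ (Fin 3) := ((u : MeasureTheory.Lp (EuclideanSpace ℝ (Fin 3)) 2 (MeasureTheory.volume : MeasureTheory.Measure (UnitAddTorus (Fin 3)))) : UnitAddTorus (Fin 3) → EuclideanSpace ℝ (Fin 3)); let D : ℝ := ν * (Literature.Analysis.FunctionSpaces.Torus.eGradNormSq uf).toReal; let P : ℝ := Literature.Analysis.FluidPDE.Torus.pairing (u : MeasureTheory.Lp (EuclideanSpace ℝ (Fin 3)) 2 (MeasureTheory.volume : MeasureTheory.Measure (UnitAddTorus (Fin 3)))) f - D; Literature.Analysis.FunctionSpaces.Torus.eGradNormSq uf ≠ ⊤ → ‖u‖ ^ 2 ≤ 16 * (∫ x, ‖f x‖ ^ 2) / ν ^ 2 → ε₀ ≤ D + Literature.Analysis.FluidPDE.Torus.nsGeneratorPairing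 ν f u (Φ₁.grad u) + 2 * θ₁ * P) := by
  rintro ⟨f, hfs, -, -, ε₀, C, Θ, ν₀, hε₀, hν₀, hcert⟩
  have hF2nn : 0 ≤ ∫ x, ‖f x‖ ^ 2 := integral_nonneg fun x => by positivity
  /- Step 0: a vanishing force is excluded by the floor at rest. -/
  have hF2pos : 0 < ∫ x, ‖f x‖ ^ 2 := by
    refine lt_of_le_of_ne hF2nn fun hF0 => ?_
    obtain ⟨N, Φ₁, θ₁, -, -, -, -, hu⟩ := hcert (ν₀ / 2) (by positivity) (by linarith)
    have hinj := rest_injects (half_pos hν₀) hu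
    have hae := ae_zero_of_integral_sq_zero hfs hF0.symm
    have hzero : (∫ x, ⟪f x, Φ₁.grad 0 x⟫_ℝ) = 0 := by
      rw [← integral_zero (α := (UnitAddTorus (Fin 3))) (G := ℝ)]
      refine integral_congr_ae ?_
      filter_upwards [hae] with x hx
      simp [hx]
    linarith
  obtain ⟨F, hFdef⟩ : ∃ F : ℝ, F = Real.sqrt (∫ x, ‖f x‖ ^ 2) := ⟨_, rfl⟩
  have hF : 0 < F := by rw [hFdef]; exact Real.sqrt_pos.2 hF2pos
  have hFsq : F ^ 2 = ∫ x, ‖f x‖ ^ 2 := by rw [hFdef]; exact Real.sq_sqrt hF2nn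
  /- Step 1: constants, the Wiener norm of the force, and the viscosity. -/
  have hγ : 0 < 1 - 2 * β := by linarith
  obtain ⟨A, hAdef⟩ : ∃ A : ℝ, A = ∑' κ, ‖mFourierCoeff (EuclideanSpace.complexify ∘ f) κ‖ := ⟨_, rfl⟩
  have hA0 : 0 ≤ A := by rw [hAdef]; exact tsum_nonneg fun κ => norm_nonneg _
  obtain ⟨C', hC'⟩ : ∃ C' : ℝ, C' = max C 1 := ⟨_, rfl⟩
  obtain ⟨Θ', hΘ'⟩ : ∃ Θ' : ℝ, Θ' = max Θ 0 := ⟨_, rfl⟩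
  have hC'1 : 1 ≤ C' := by rw [hC']; exact le_max_right _ _
  have hΘ'0 : 0 ≤ Θ' := by rw [hΘ']; exact le_max_right _ _
  obtain ⟨K, hKdef⟩ : ∃ K : ℝ, K = 4500 * (1 + 2 * Θ') * C' ^ 2 * (A + 1) := ⟨_, rfl⟩
  have hK0 : 0 < K := by rw [hKdef]; positivity
  obtain ⟨t, htdef⟩ : ∃ t : ℝ, t = ε₀ / (2 * K) := ⟨_, rfl⟩
  have ht0 : 0 < t := by rw [htdef]; positivity
  obtain ⟨ν₁, hν₁def⟩ : ∃ ν₁ : ℝ, ν₁ = t ^ (1 / (1 - 2 * β)) := ⟨_, rfl⟩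
  have hν₁0 : 0 < ν₁ := by rw [hν₁def]; exact Real.rpow_pos_of_pos ht0 _
  obtain ⟨ν₂, hν₂def⟩ : ∃ ν₂ : ℝ, ν₂ = F / Real.sqrt (A + 1) := ⟨_, rfl⟩
  have hsA : 0 < Real.sqrt (A + 1) := Real.sqrt_pos.2 (by linarith)
  have hν₂0 : 0 < ν₂ := by rw [hν₂def]; positivity
  obtain ⟨ν, hνdef⟩ : ∃ ν : ℝ, ν = min (ν₀ / 2) (min ν₁ ν₂) := ⟨_, rfl⟩
  have hν : 0 < ν := by rw [hνdef]; exact lt_min (by positivity) (lt_min hν₁0 hν₂0)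
  have hνν₀ : ν < ν₀ := by
    have : ν ≤ ν₀ / 2 := by rw [hνdef]; exact min_le_left _ _
    linarith
  have hνν₁ : ν ≤ ν₁ := by rw [hνdef]; exact (min_le_right _ _).trans (min_le_left _ _)
  have hνν₂ : ν ≤ ν₂ := by rw [hνdef]; exact (min_le_right _ _).trans (min_le_right _ _)
  obtain ⟨N, Φ₁, θ₁, hN, hband, hθ₁, hθ₁', hu⟩ := hcert ν hν hνν₀
  have hΘ : 0 ≤ Θ := by linarith
  have hΘeq : Θ' = Θ := by rw [hΘ']; exact max_eq_left hΘ
  have hN0 : (0 : ℝ) ≤ N := Nat.cast_nonneg N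
  have hNs : (N : ℝ) ≤ C' * ν ^ (-β) := by
    refine hN.trans (mul_le_mul_of_nonneg_right ?_ (Real.rpow_nonneg hν.le _))
    rw [hC']; exact le_max_left _ _
  /- Step 2: the multiplier at rest, its largest coefficient, the Wiener bound. -/
  obtain ⟨G, hGdef⟩ : ∃ G : (UnitAddTorus (Fin 3)) → (EuclideanSpace ℝ (Fin 3)), G = Φ₁.grad 0 := ⟨_, rfl⟩
  have hinj : ε₀ ≤ ∫ x, ⟪f x, G x⟫_ℝ := by rw [hGdef]; exact rest_injects hν hu
  have hG : Torus.IsSmooth G := by rw [hGdef]; exact isSmooth_grad Φ₁ 0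
  have hbandG : ∀ κ, (N : ℝ) ^ 2 < Torus.freqNormSq κ → mFourierCoeff (EuclideanSpace.complexify ∘ G) κ = 0 := by
    rw [hGdef]; exact fc_grad_eq_zero Φ₁ hband 0
  obtain ⟨q, hqmem, hqmax⟩ := Finset.exists_max_image (Torus.freqBall (d := Fin 3) N)
    (fun κ => ‖(mFourierCoeff (EuclideanSpace.complexify ∘ G) κ)‖) ⟨0, Torus.zero_mem_freqBall N⟩
  obtain ⟨g, hgdef⟩ : ∃ g : (EuclideanSpace ℂ (Fin 3)), g = (mFourierCoeff (EuclideanSpace.complexify ∘ G) q) := ⟨_, rfl⟩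
  have hfG : ∫ x, ⟪f x, G x⟫_ℝ ≤ A * ‖g‖ := by
    rw [hAdef, hgdef]; exact integral_inner_le_tsum_mul_max hfs hG.continuous hbandG hqmax
  have hg0 : g ≠ 0 := by
    intro h
    rw [h, norm_zero, mul_zero] at hfG
    linarith
  have hq0 : q ≠ 0 := by
    rintro rfl
    apply hg0
    rw [hgdef, hGdef]
    exact fc_grad_zero Φ₁ _
  have hfqN : Torus.freqNormSq q ≤ (N : ℝ) ^ 2 := Torus.mem_freqBall.1 hqmem
  have hfq1 : 1 ≤ Torus.freqNormSq q := Torus.one_le_freqNormSq_of_ne_zero hq0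
  have hN1 : (1 : ℝ) ≤ N := by nlinarith
  have hgt : ((fun j => ((q) j : ℂ)) ⬝ᵥ (WithLp.ofLp (g))) = 0 := by rw [hgdef, hGdef]; exact dotc_fc_grad Φ₁ _ q
  /- Step 3: the amplitude and the axis beat. -/
  obtain ⟨α, hαdef⟩ : ∃ α : ℝ, α = Real.sqrt (10 / 9 * (A + 1)) := ⟨_, rfl⟩
  have hα0 : 0 ≤ α := by rw [hαdef]; exact Real.sqrt_nonneg _
  have hα2 : α ^ 2 = 10 / 9 * (A + 1) := by rw [hαdef, Real.sq_sqrt]; positivity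
  obtain ⟨p, zA, zB, gain, hNp, hNpq, hN5, hLp, hLpq, hdA, hdB, hBq, hzA, hzB, hbeat, hgain⟩ :=
    axis_beat_data hq0 hfqN g hg0 hgt hα0
  have hp0 : p ≠ 0 := ne_zero_of_freqNormSq_pos (sq_nonneg _) hNp
  have hpq0 : p + q ≠ 0 := ne_zero_of_freqNormSq_pos (sq_nonneg _) hNpq
  have hLm := two_freq_le (p := p) (q := q) hLp hLpq
  rw [hgdef, hGdef] at hbeat
  -- the negated polarisations
  have hzA' : ‖-zA‖ ≤ α := by rw [norm_neg]; exact hzA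
  have hzB' : ‖-zB‖ ≤ α := by rw [norm_neg]; exact hzB
  have hdA' : ((fun j => ((p) j : ℂ)) ⬝ᵥ (WithLp.ofLp (-zA))) = 0 := by rw [dotc_neg_right, hdA, neg_zero]
  have hdB' : ((fun j => (((p + q)) j : ℂ)) ⬝ᵥ (WithLp.ofLp (-zB))) = 0 := by rw [dotc_neg_right, hdB, neg_zero]
  have hBq' : ((fun j => ((q) j : ℂ)) ⬝ᵥ (WithLp.ofLp (-zB))) = 0 := by rw [dotc_neg_right, hBq, neg_zero]
  have hbeat' : Real.pi * (conj (((fun j => ((q) j : ℂ)) ⬝ᵥ (WithLp.ofLp (-zA)))) *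
      ⟪(mFourierCoeff (EuclideanSpace.complexify ∘ (Φ₁.grad 0)) q), -zB⟫_ℂ).im ≤ -gain := by
    rw [dotc_neg_right, map_neg, inner_neg_right, neg_mul_neg]
    exact hbeat
  /- Step 4: the two dressed states and their admissibility. -/
  obtain ⟨up, hup⟩ := exists_state ![p, p + q] ![zA, zB] (two_ne_zero' hp0 hpq0) (two_dotc hdA hdB)
  obtain ⟨um, hum⟩ := exists_state ![p, p + q] ![-zA, -zB] (two_ne_zero' hp0 hpq0) (two_dotc hdA' hdB')
  have hball : (α + α) ^ 2 ≤ 16 * F ^ 2 / ν ^ 2 := by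
    -- `(α+α)² = (40/9)(A+1) ≤ 16 F²/ν²` since `ν ≤ F/√(A+1)`
    have h1 : ν * Real.sqrt (A + 1) ≤ F := by
      have := mul_le_mul_of_nonneg_right hνν₂ hsA.le
      rwa [hν₂def, div_mul_cancel₀ _ hsA.ne'] at this
    have h2 : ν ^ 2 * (A + 1) ≤ F ^ 2 := by
      have h0 : 0 ≤ ν * Real.sqrt (A + 1) := by positivity
      have := pow_le_pow_left₀ h0 h1 2
      rwa [mul_pow, Real.sq_sqrt (by linarith)] at this
    rw [show (α + α) ^ 2 = 4 * α ^ 2 by ring, hα2, le_div_iff₀ (by positivity)]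
    have e : 4 * (10 / 9 * (A + 1)) * ν ^ 2 = 40 / 9 * (ν ^ 2 * (A + 1)) := by ring
    rw [e]
    linarith [h2, sq_nonneg F]
  have hup1 : Torus.eGradNormSq (((up : (Torus.energySpace (Fin 3))) : (Lp (EuclideanSpace ℝ (Fin 3)) 2 (volume : Measure (UnitAddTorus (Fin 3))))) : (UnitAddTorus (Fin 3)) → (EuclideanSpace ℝ (Fin 3))) ≠ ⊤ := by
    rw [eGradNormSq_congr_ae' hup]; exact eGradNormSq_modes_ne_top
  have hum1 : Torus.eGradNormSq (((um : (Torus.energySpace (Fin 3))) : (Lp (EuclideanSpace ℝ (Fin 3)) 2 (volume : Measure (UnitAddTorus (Fin 3))))) : (UnitAddTorus (Fin 3)) → (EuclideanSpace ℝ (Fin 3))) ≠ ⊤ := by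
    rw [eGradNormSq_congr_ae' hum]; exact eGradNormSq_modes_ne_top
  have hsum : ∑ m, ‖(![zA, zB] : Fin 2 → (EuclideanSpace ℂ (Fin 3))) m‖ ≤ α + α := by
    simp only [Fin.sum_univ_two, Matrix.cons_val_zero, Matrix.cons_val_one]
    linarith
  have hsum0 : 0 ≤ ∑ m, ‖(![zA, zB] : Fin 2 → (EuclideanSpace ℂ (Fin 3))) m‖ := Finset.sum_nonneg fun m _ => norm_nonneg _
  have hsum' : ∑ m, ‖(![-zA, -zB] : Fin 2 → (EuclideanSpace ℂ (Fin 3))) m‖ ≤ α + α := by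
    simp only [Fin.sum_univ_two, Matrix.cons_val_zero, Matrix.cons_val_one]
    linarith
  have hsum0' : 0 ≤ ∑ m, ‖(![-zA, -zB] : Fin 2 → (EuclideanSpace ℂ (Fin 3))) m‖ := Finset.sum_nonneg fun m _ => norm_nonneg _
  have hup2 : ‖up‖ ^ 2 ≤ 16 * (∫ x, ‖f x‖ ^ 2) / ν ^ 2 := by
    rw [norm_sq_of_ae hup, ← hFsq]
    exact (integral_norm_sq_modes_le.trans (pow_le_pow_left₀ hsum0 hsum 2)).trans hball
  have hum2 : ‖um‖ ^ 2 ≤ 16 * (∫ x, ‖f x‖ ^ 2) / ν ^ 2 := by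
    rw [norm_sq_of_ae hum, ← hFsq]
    exact (integral_norm_sq_modes_le.trans (pow_le_pow_left₀ hsum0' hsum' 2)).trans hball
  /- Step 5: the sign choice and the FLOOR at the dressed state. -/
  have hmain : gain + ε₀ ≤ (∫ x, ⟪f x, Φ₁.grad 0 x⟫_ℝ) +
      (1 + 2 * Θ) * (ν * (4 * Real.pi ^ 2 * (((4 * N + 1 : ℕ)) : ℝ) ^ 2 * (α + α) ^ 2)) := by
    by_cases hP : 0 ≤ ∫ x, ⟪(∑ mm, Torus.realTrigPoly {![p, p + q] mm} (fun _ => ![zA, zB] mm)) x, f x⟫_ℝ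
    · have hu' := hu up
      dsimp only at hu'
      have hfl := hu' hup1 hup2
      exact floor_beat_at_rest_inj hν Φ₁ hband hθ₁ hθ₁' up hup hdA hdB hBq hzA hzB hNp hNpq hN5 hLm hbeat hP hfl
    · have hP' : 0 ≤ ∫ x, ⟪(∑ mm, Torus.realTrigPoly {![p, p + q] mm} (fun _ => ![-zA, -zB] mm)) x, f x⟫_ℝ := by
        rw [pairing_two_neg hfs.integrable]
        linarith [not_le.1 hP]
      have hu' := hu um
      dsimp only at hu'
      have hfl := hu' hum1 hum2
      exact floor_beat_at_rest_inj hν Φ₁ hband hθ₁ hθ₁' um hum hdA' hdB' hBq' hzA' hzB' hNp hNpq hN5 hLm hbeat' hP' hfl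
  /- Step 6: the endgame. -/
  rw [← hGdef] at hmain
  have e2 : ((((4 * N + 1 : ℕ)) : ℝ)) = 4 * (N : ℝ) + 1 := by push_cast; ring
  rw [e2] at hmain
  have hνN : ν * (N : ℝ) ^ 2 ≤ C' ^ 2 * ν ^ (1 - 2 * β) := nu_mul_sq_le hν hN0 hNs
  have hX : 4500 * (1 + 2 * Θ) * C' ^ 2 * (A + 1) * ν ^ (1 - 2 * β) < ε₀ := by
    have h1 : ν ^ (1 - 2 * β) ≤ t := rpow_le_of_le_root hν ht0 hγ (hν₁def ▸ hνν₁)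
    have h2 : K * ν ^ (1 - 2 * β) ≤ K * t := mul_le_mul_of_nonneg_left h1 hK0.le
    have h3 : K * t = ε₀ / 2 := by rw [htdef]; field_simp
    rw [h3] at h2
    rw [hKdef, hΘeq] at h2
    linarith
  exact endgame_below hΘ hA0 (norm_nonneg g) hν hC'1 hN1 hνN hX hα2 hfG hgain hmain

end Summit.AnomalousDissipation.AnomalousDissipation.Theorems.KolmogorovFloor.Negative
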